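import Summits.HodgeConjecture.HodgeConjecture.Theorems.F0P3cStCharTSXIGData        -- ★ p850103 (this seat) «XIG-DATA★» core: `exists_xigData`
import Summits.HodgeConjecture.HodgeConjecture.Theorems.F0P3cStCharTSRepHyperbolic  -- ★ (F0P3-p01 g20) REP-HYPERBOLIC: `forall_rep_hyperbolic_of_cover`
import Summits.HodgeConjecture.HodgeConjecture.Theorems.F0P3cStCharTSLevelPickInst  -- ★ p850088 LEVEL-PICK-INST (LH4-p02 g3): `exists_level_K₁_box_pick_subgroup`
import HarnessLib

/-!
# F0 · P3c · line LH6 «StCharTS» — road (D) «DEEP-FL», «XIG-DATA★» FROM THE LEVELS: the `H`-level `S′`, its BOX ∕ PICK, the reps read hyperbolic — the owner's (a)–(e) in one call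
# (sibling of ★ `F0P3cStCharTSXIGData`; kept apart for the 400-line rule)

Cell `pub/hodgecm-mathlib`, crux H413 = `stmt-HodgeConjecture-24833` (lane `--supports … --as helper`), route HCCMUnconditional; seat LH6-p03 (g2); road (D) owner LH6-p04 (g3) deal
2026-09-02T06:59:51Z «XIG-DATA★», census `F0/P3b/LH6-p03/g2/CENSUS-XIG-DATA.v1.md` (29a01dae02a4f9f0).  THEOREMS ONLY, sorry-free, ★-only imports; no definition ∕ instance ∕ notation ∕
named fact.  HONEST LABEL: HC_CM is proved only modulo the 7 printed citations (2 remaining: hLiu418 = stmt-HodgeConjecture-24832, h413 = stmt-HodgeConjecture-24833) until rung 0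
closes; count-neutral plumbing of road (D).

* §5 `exists_xigData_hyperbolic` — ★ `exists_xigData` + (e): every representative `u ∈ F` is hlevi-ORIENTED hyperbolic (★ REP-HYPERBOLIC `forall_rep_hyperbolic_of_cover`, whose inputs
  `hb′`∕`he`∕`hSn`∕`hF` are conjuncts of ★ `exists_xigData`), given the level-`r` text of `K_n`.
* §6 `exists_levelSubgroupH` — the OPEN subgroup `S′ ≤ T₂ × U(Φ₁)_v` cut out by `↑x.1 ∈ K₂ ∧ x.2 ∈ K₁` (S-PRIME-DATA's `Subgroup` + `IsOpen`).
* §7 **`exists_xigData_of_levels`** — from an `H`-datum `𝓘₂` and a box level `nμ`: `(n′, K₁)` and BOX∕PICK by ★ LEVEL-PICK-INST, `S′` by §6, then §5 — the data part of the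
  XIG-ASSEMBLY head in ONE `obtain`.

## References
* [Rogawski1990] J. D. Rogawski, *Automorphic Representations of Unitary Groups in Three Variables*, Ann. of Math. Stud. 123 (1990): §4.9 Lemma 4.9.2, (4.9.4) pp. 55–56;
  §12.7 Lemma 12.7.3 (proof) p. 195.
* [Casselman1995] W. Casselman, *Introduction to the theory of admissible representations of p-adic reductive groups* (1995): §1.4 Prop. 1.4.4 p. 14.
-/

set_option autoImplicit false
-- the mandated namespace has the single-problem summit's repeated segment (`HodgeConjecture.HodgeConjecture`)
set_option linter.dupNamespace false

noncomputable section

open Matrix NumberField IsDedekindDomain Topology Filter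
open scoped MatrixGroups Pointwise
open Literature.NumberTheory.Rogawski1990 Literature.NumberTheory.Automorphic Literature.NumberTheory.Automorphic.UnitaryGroup
open Literature.NumberTheory.GaloisRepresentations
open Literature.NumberTheory (Rogawski1990.qsForm)
open Summit.HodgeConjecture.HodgeConjecture.Cruxes.H413.F0P3cStCharTSXIGData (exists_xigData)

namespace Summit.HodgeConjecture.HodgeConjecture.Cruxes.H413.F0P3cStCharTSXIGDataLevels

variable (L : Type) [Field L] [NumberField L] [IsCMField L] (v : HeightOneSpectrum (𝓞 ↥(maximalRealSubfield L)))
  (w : PlacesOver L v) (hw : IsCMField.complexConj L • w.1 = w.1)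

/-! ## §5 «XIG-DATA» with the reps read HYPERBOLIC (★ REP-HYPERBOLIC folded in) -/

include hw in
set_option maxHeartbeats 1600000 in  -- statement-level `whnf` on the CM carriers + destructuring of the long ∃ (same class as ★ `exists_cosetCover`)
/-- **«XIG-DATA★» + (e)**: `exists_xigData` with, for every representative `u ∈ F`, the HYPERBOLIC readings of ★ REP-HYPERBOLIC `forall_rep_hyperbolic_of_cover` (KIT-B shape
`∃ d′, glDiagonal d′ = ↑u.1 ∧ |(d′₁)_w| < |(d′₀)_w| ∧ σ_w((d′₀)_w)(d′₁)_w = 1`; `E₂`∕SHELL-ON shape `E₂ u.1 = diag(d₀, d₁)`, `|d₁| < |d₀|`, `|d₀||d₁| = 1`, `σ_w d₀·d₁ = 1`; `|γ₂(u)|_w = 1`),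
given the level-`r` text `hK` of ★ p849876 for `K_n` (`r < 1`). [cite: Rogawski1990, §4.9 Lemma 4.9.2, (4.9.4) pp. 55–56; §12.7 Lemma 12.7.3 (proof) p. 195] [cite: Casselman1995, §1.4 Prop. 1.4.4 p. 14] -/
theorem exists_xigData_hyperbolic (hns : ∀ w' : PlacesOver L v, IsCMField.complexConj L • w'.1 = w'.1)
    (𝓘 : (cmBorelTriple L 3 v).IwahoriDatum) (n : ℕ) {r : WithZero (Multiplicative ℤ)} (hr : r < 1)
    (hK : ∀ k ∈ 𝓘.K n, ∀ i j, Valued.v ((((localNonsplitEquiv (IsCMField.complexConj L) (qsForm L) (IsCMField.complexConj_ne_one L) w hw k :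
        ↥(unitaryGroupOfForm (galAdicCompletionMap (L := L) (IsCMField.complexConj L) hw) (placeForm (qsForm L) w.1))) :
        GL (Fin 3) (w.1.adicCompletion L)) : Matrix (Fin 3) (Fin 3) (w.1.adicCompletion L)) i j - (1 : Matrix (Fin 3) (Fin 3) (w.1.adicCompletion L)) i j) ≤ r)
    (K₀ : Subgroup ↥(unitaryGroupOfForm (conjLocal L (IsCMField.complexConj L) v) (cmLocalForm L 3 v)))
    (hKK₀ : ∀ n, ∀ k ∈ K₀, ∀ κ ∈ 𝓘.K n, k⁻¹ * κ * k ∈ 𝓘.K n)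
    (hK₀ : ∀ k : ↥(unitaryGroupOfForm (conjLocal L (IsCMField.complexConj L) v) (cmLocalForm L 3 v)), k ∈ K₀ ↔
      ((((localNonsplitEquiv (IsCMField.complexConj L) (Rogawski1990.qsForm L) (IsCMField.complexConj_ne_one L) w hw) k :
        ↥(unitaryGroupOfForm (galAdicCompletionMap (L := L) (IsCMField.complexConj L) hw) (placeForm (Rogawski1990.qsForm L) w.1))) :
          GL (Fin 3) (w.1.adicCompletion L)) ∈ glInt 3 (w.1.adicCompletion L)))
    {z : ↥(unitaryGroupOfForm (conjLocal L (IsCMField.complexConj L) v) (cmLocalForm L 3 v))} {β α : w.1.adicCompletion L}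
    (hz : (((localNonsplitEquiv (IsCMField.complexConj L) (qsForm L) (IsCMField.complexConj_ne_one L) w hw z :
        ↥(unitaryGroupOfForm (galAdicCompletionMap (L := L) (IsCMField.complexConj L) hw) (placeForm (qsForm L) w.1))) :
        GL (Fin 3) (w.1.adicCompletion L)) : Matrix (Fin 3) (Fin 3) (w.1.adicCompletion L)) = β • (1 : Matrix (Fin 3) (Fin 3) (w.1.adicCompletion L)))
    (hβ : Valued.v β = 1)
    (ha : (((localNonsplitEquiv (IsCMField.complexConj L) (qsForm L) (IsCMField.complexConj_ne_one L) w hw 𝓘.a :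
        ↥(unitaryGroupOfForm (galAdicCompletionMap (L := L) (IsCMField.complexConj L) hw) (placeForm (qsForm L) w.1))) :
        GL (Fin 3) (w.1.adicCompletion L)) : Matrix (Fin 3) (Fin 3) (w.1.adicCompletion L)) =
        Matrix.diagonal ![α, 1, ((galAdicCompletionMap (L := L) (IsCMField.complexConj L) hw) α)⁻¹])
    (hα0 : α ≠ 0) (hα1 : Valued.v α < 1) {m : ℕ} (hm : 1 ≤ m) (hbM : z * 𝓘.a ^ m ∈ (cmBorelTriple L 3 v).M)
    (S' : Subgroup (↥(cmBorelTriple L 2 v).M × (cmDatum L 1 (Matrix.of fun i j : Fin 1 => if i.val + j.val + 1 = 1 then (1 : L) else 0)).Local v))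
    (hS' : IsOpen (S' : Set (↥(cmBorelTriple L 2 v).M × (cmDatum L 1 (Matrix.of fun i j : Fin 1 => if i.val + j.val + 1 = 1 then (1 : L) else 0)).Local v)))
    (hpick : ∀ k ∈ S', endoEmbLocal L v ((k.1 : ↥(unitaryGroupOfForm (conjLocal L (IsCMField.complexConj L) v) (cmLocalForm L 2 v))), k.2) ∈ 𝓘.K n) :
    ∃ (w₀ : ↥(unitaryGroupOfForm (conjLocal L (IsCMField.complexConj L) v) (cmLocalForm L 3 v))) (b' : ↥(cmBorelTriple L 3 v).M) (Sn : Subgroup ↥(cmBorelTriple L 3 v).M)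
      (F : Finset (↥(cmBorelTriple L 2 v).M × (cmDatum L 1 (Matrix.of fun i j : Fin 1 => if i.val + j.val + 1 = 1 then (1 : L) else 0)).Local v)),
      Units.val (w₀ : GL (Fin 3) (LocalRing L v)) = cmLocalForm L 3 v ∧ w₀ ∈ K₀ ∧ (∀ n, ∀ κ ∈ 𝓘.K n, w₀ * κ * w₀⁻¹ ∈ 𝓘.K n) ∧
      (b' : ↥(unitaryGroupOfForm (conjLocal L (IsCMField.complexConj L) v) (cmLocalForm L 3 v))) = w₀ * (z * 𝓘.a ^ m) * w₀⁻¹ ∧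
      (((localNonsplitEquiv (IsCMField.complexConj L) (qsForm L) (IsCMField.complexConj_ne_one L) w hw
          (b' : ↥(unitaryGroupOfForm (conjLocal L (IsCMField.complexConj L) v) (cmLocalForm L 3 v))) :
        ↥(unitaryGroupOfForm (galAdicCompletionMap (L := L) (IsCMField.complexConj L) hw) (placeForm (qsForm L) w.1))) :
        GL (Fin 3) (w.1.adicCompletion L)) : Matrix (Fin 3) (Fin 3) (w.1.adicCompletion L)) =
        Matrix.diagonal ![β * ((galAdicCompletionMap (L := L) (IsCMField.complexConj L) hw) α)⁻¹ ^ m, β, β * α ^ m] ∧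
      Valued.v (β * α ^ m) < Valued.v (β * ((galAdicCompletionMap (L := L) (IsCMField.complexConj L) hw) α)⁻¹ ^ m) ∧
      Sn = (𝓘.K n).subgroupOf (cmBorelTriple L 3 v).M ∧ IsCompact (Sn : Set ↥(cmBorelTriple L 3 v).M) ∧
      (∀ s ∈ Sn, (s : ↥(unitaryGroupOfForm (conjLocal L (IsCMField.complexConj L) v) (cmLocalForm L 3 v))) ∈ 𝓘.K n) ∧
      (∀ k ∈ S', ∃ s ∈ Sn,
        endoEmbLocal L v ((k.1 : ↥(unitaryGroupOfForm (conjLocal L (IsCMField.complexConj L) v) (cmLocalForm L 2 v))), k.2) =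
          ((s : ↥(cmBorelTriple L 3 v).M) : ↥(unitaryGroupOfForm (conjLocal L (IsCMField.complexConj L) v) (cmLocalForm L 3 v)))) ∧
      (∀ u ∈ F, ∃ t ∈ b' • (Sn : Set ↥(cmBorelTriple L 3 v).M),
        (t : ↥(unitaryGroupOfForm (conjLocal L (IsCMField.complexConj L) v) (cmLocalForm L 3 v))) =
          endoEmbLocal L v ((u.1 : ↥(unitaryGroupOfForm (conjLocal L (IsCMField.complexConj L) v) (cmLocalForm L 2 v))), u.2)) ∧
      (↑F : Set (↥(cmBorelTriple L 2 v).M ×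
        (cmDatum L 1 (Matrix.of fun i j : Fin 1 => if i.val + j.val + 1 = 1 then (1 : L) else 0)).Local v)).PairwiseDisjoint
          (fun u => u • (S' : Set (↥(cmBorelTriple L 2 v).M ×
            (cmDatum L 1 (Matrix.of fun i j : Fin 1 => if i.val + j.val + 1 = 1 then (1 : L) else 0)).Local v))) ∧
      (fun x : ↥(cmBorelTriple L 2 v).M ×
          (cmDatum L 1 (Matrix.of fun i j : Fin 1 => if i.val + j.val + 1 = 1 then (1 : L) else 0)).Local v =>
        endoEmbLocal L v ((x.1 : ↥(unitaryGroupOfForm (conjLocal L (IsCMField.complexConj L) v) (cmLocalForm L 2 v))), x.2)) ⁻¹'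
          (Subtype.val '' (b' • (Sn : Set ↥(cmBorelTriple L 3 v).M))) =
        ⋃ u ∈ F, u • (S' : Set (↥(cmBorelTriple L 2 v).M ×
            (cmDatum L 1 (Matrix.of fun i j : Fin 1 => if i.val + j.val + 1 = 1 then (1 : L) else 0)).Local v)) ∧
      (∀ (x : ↥(cmBorelTriple L 2 v).M ×
          (cmDatum L 1 (Matrix.of fun i j : Fin 1 => if i.val + j.val + 1 = 1 then (1 : L) else 0)).Local v)
        (t : ↥(cmBorelTriple L 3 v).M),
        (t : ↥(unitaryGroupOfForm (conjLocal L (IsCMField.complexConj L) v) (cmLocalForm L 3 v))) =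
          endoEmbLocal L v ((x.1 : ↥(unitaryGroupOfForm (conjLocal L (IsCMField.complexConj L) v) (cmLocalForm L 2 v))), x.2) →
        (t ∈ b' • (Sn : Set ↥(cmBorelTriple L 3 v).M) ↔
          ∃ u ∈ F, x ∈ u • (S' : Set (↥(cmBorelTriple L 2 v).M ×
            (cmDatum L 1 (Matrix.of fun i j : Fin 1 => if i.val + j.val + 1 = 1 then (1 : L) else 0)).Local v)))) ∧
      -- (e) the representatives are hlevi-ORIENTED hyperbolic (★ REP-HYPERBOLIC, conclusion verbatim)
      ∀ u ∈ F,
        (∃ d' : Fin 2 → (LocalRing L v)ˣ,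
          glDiagonal 2 (LocalRing L v) d' = ((u.1 : ↥(unitaryGroupOfForm (conjLocal L (IsCMField.complexConj L) v) (cmLocalForm L 2 v))) : GL (Fin 2) (LocalRing L v)) ∧
          Valued.v (((d' 1 : (LocalRing L v)ˣ) : LocalRing L v) w) < Valued.v (((d' 0 : (LocalRing L v)ˣ) : LocalRing L v) w) ∧
          galAdicCompletionMap (L := L) (IsCMField.complexConj L) hw (((d' 0 : (LocalRing L v)ˣ) : LocalRing L v) w) * ((d' 1 : (LocalRing L v)ˣ) : LocalRing L v) w = 1) ∧
        (∃ d₀ d₁ : w.1.adicCompletion L,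
          (((localNonsplitEquiv (IsCMField.complexConj L) (Matrix.of fun i j : Fin 2 => if i.val + j.val + 1 = 2 then (1 : L) else 0) (IsCMField.complexConj_ne_one L) w hw
                (u.1 : ↥(unitaryGroupOfForm (conjLocal L (IsCMField.complexConj L) v) (cmLocalForm L 2 v))) :
              ↥(unitaryGroupOfForm (galAdicCompletionMap (L := L) (IsCMField.complexConj L) hw) (placeForm (Matrix.of fun i j : Fin 2 => if i.val + j.val + 1 = 2 then (1 : L) else 0) w.1))) :
              GL (Fin 2) (w.1.adicCompletion L)) : Matrix (Fin 2) (Fin 2) (w.1.adicCompletion L)) = Matrix.diagonal ![d₀, d₁] ∧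
          Valued.v d₁ < Valued.v d₀ ∧ Valued.v d₀ * Valued.v d₁ = 1 ∧ galAdicCompletionMap (L := L) (IsCMField.complexConj L) hw d₀ * d₁ = 1) ∧
        Valued.v (finGammaTwo L v ((u.1 : ↥(unitaryGroupOfForm (conjLocal L (IsCMField.complexConj L) v) (cmLocalForm L 2 v))), u.2) w) = 1 := by
  refine Exists.elim (exists_xigData L v w hw hns 𝓘 n K₀ hKK₀ hK₀ hz hβ ha hα0 hα1 hm hbM S' hS' hpick) fun w₀ h => ?_
  refine Exists.elim h fun b' h => ?_
  refine Exists.elim h fun Sn h => ?_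
  refine Exists.elim h fun F h => ?_
  exact ⟨w₀, b', Sn, F, h.1, h.2.1, h.2.2.1, h.2.2.2.1, h.2.2.2.2.1, h.2.2.2.2.2.1, h.2.2.2.2.2.2.1, h.2.2.2.2.2.2.2.1, h.2.2.2.2.2.2.2.2.1, h.2.2.2.2.2.2.2.2.2.1,
    h.2.2.2.2.2.2.2.2.2.2.1, h.2.2.2.2.2.2.2.2.2.2.2.1, h.2.2.2.2.2.2.2.2.2.2.2.2.1, h.2.2.2.2.2.2.2.2.2.2.2.2.2,
    F0P3cStCharTSRepHyperbolic.forall_rep_hyperbolic_of_cover L v w hw (𝓘.K n) hr hK h.2.2.2.2.1 h.2.2.2.2.2.1 Sn h.2.2.2.2.2.2.2.2.1 F h.2.2.2.2.2.2.2.2.2.2.1⟩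

/-! ## §6 The `H`-level subgroup `S′ = (T₂ ∩ K_{2,n′}) × K₁` of `T₂ × U(Φ₁)_v` (S-PRIME-DATA's `Subgroup` + `IsOpen`) -/

/-- **The `H`-level `S′`.**  For open subgroups `K₂ ≤ U(Φ₂)_v`, `K₁ ≤ U(Φ₁)_v` there is an OPEN subgroup `S′ ≤ T₂ × U(Φ₁)_v` with `x ∈ S′ ↔ ↑x.1 ∈ K₂ ∧ x.2 ∈ K₁` (the comap of
`K₂ × K₁` under `T₂ ↪ U(Φ₂)_v` times the identity) — the `S′` of ★ COSET-COVER ∕ ★ LEVEL-PICK-INST `exists_level_K₁_box_pick_subgroup` ∕ ★ HTAU-ON-COSET. [cite: Casselman1995, §1.4 Prop. 1.4.4 p. 14] -/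
theorem exists_levelSubgroupH (K₂ : Subgroup ↥(unitaryGroupOfForm (conjLocal L (IsCMField.complexConj L) v) (cmLocalForm L 2 v)))
    (hK₂ : IsOpen (K₂ : Set ↥(unitaryGroupOfForm (conjLocal L (IsCMField.complexConj L) v) (cmLocalForm L 2 v))))
    (K₁ : Subgroup ((cmDatum L 1 (Matrix.of fun i j : Fin 1 => if i.val + j.val + 1 = 1 then (1 : L) else 0)).Local v))
    (hK₁ : IsOpen (K₁ : Set ((cmDatum L 1 (Matrix.of fun i j : Fin 1 => if i.val + j.val + 1 = 1 then (1 : L) else 0)).Local v))) :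
    ∃ S' : Subgroup (↥(cmBorelTriple L 2 v).M × (cmDatum L 1 (Matrix.of fun i j : Fin 1 => if i.val + j.val + 1 = 1 then (1 : L) else 0)).Local v),
      (∀ x, x ∈ S' ↔ ((x.1 : ↥(unitaryGroupOfForm (conjLocal L (IsCMField.complexConj L) v) (cmLocalForm L 2 v))) ∈ K₂ ∧ x.2 ∈ K₁)) ∧
      IsOpen (S' : Set (↥(cmBorelTriple L 2 v).M × (cmDatum L 1 (Matrix.of fun i j : Fin 1 => if i.val + j.val + 1 = 1 then (1 : L) else 0)).Local v)) := by
  refine ⟨(K₂.prod K₁).comap (((cmBorelTriple L 2 v).M.subtype).prodMap (MonoidHom.id _)), fun x => ?_, ?_⟩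
  · rw [Subgroup.mem_comap, MonoidHom.coe_prodMap, Prod.map_apply, Subgroup.mem_prod]
    rfl
  · rw [Subgroup.coe_comap, Subgroup.coe_prod]
    exact (hK₂.prod hK₁).preimage (continuous_subtype_val.prodMap continuous_id)

/-! ## §7 «XIG-DATA» from the levels: `(n′, K₁, S′)` by ★ LEVEL-PICK-INST, then §5 -/

include hw in
set_option maxHeartbeats 1600000 in  -- statement-level `whnf` on the CM carriers + destructuring of the long ∃ (same class as ★ `exists_cosetCover`)
/-- **«XIG-DATA★» FROM THE LEVELS (owner's spec (a)–(e) in one call).**  Given the XIG binders, the package clauses (5)∕(11), the level-`r` text of `K_n`, an `H`-side Iwahori datum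
`𝓘₂` (★ U2 Inst `exists_cmIwahoriDatum₂`) and a box level `nμ` (★ HTAU-ON-COSET): there are `n′`, a compact open `K₁ ≤ U(Φ₁)_v`, the OPEN `H`-level `S′ = (T₂ ∩ K_{2,n′}) × K₁` with
the BOX property at `nμ` (⇒ `hτ` by ★ p849908) and the PICK `Ψ₀(S′) ⊆ K_n` (★ LEVEL-PICK-INST), and then `(w₀, b′, S_n, F)` with every conjunct of `exists_xigData_hyperbolic`.
[cite: Rogawski1990, §4.9 Lemma 4.9.2, (4.9.4) pp. 55–56; §12.7 Lemma 12.7.3 (proof) p. 195] [cite: Casselman1995, §1.4 Prop. 1.4.4 p. 14] -/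
theorem exists_xigData_of_levels (hns : ∀ w' : PlacesOver L v, IsCMField.complexConj L • w'.1 = w'.1)
    (𝓘 : (cmBorelTriple L 3 v).IwahoriDatum) (n : ℕ) {r : WithZero (Multiplicative ℤ)} (hr : r < 1)
    (hK : ∀ k ∈ 𝓘.K n, ∀ i j, Valued.v ((((localNonsplitEquiv (IsCMField.complexConj L) (qsForm L) (IsCMField.complexConj_ne_one L) w hw k :
        ↥(unitaryGroupOfForm (galAdicCompletionMap (L := L) (IsCMField.complexConj L) hw) (placeForm (qsForm L) w.1))) :
        GL (Fin 3) (w.1.adicCompletion L)) : Matrix (Fin 3) (Fin 3) (w.1.adicCompletion L)) i j - (1 : Matrix (Fin 3) (Fin 3) (w.1.adicCompletion L)) i j) ≤ r)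
    (K₀ : Subgroup ↥(unitaryGroupOfForm (conjLocal L (IsCMField.complexConj L) v) (cmLocalForm L 3 v)))
    (hKK₀ : ∀ n, ∀ k ∈ K₀, ∀ κ ∈ 𝓘.K n, k⁻¹ * κ * k ∈ 𝓘.K n)
    (hK₀ : ∀ k : ↥(unitaryGroupOfForm (conjLocal L (IsCMField.complexConj L) v) (cmLocalForm L 3 v)), k ∈ K₀ ↔
      ((((localNonsplitEquiv (IsCMField.complexConj L) (Rogawski1990.qsForm L) (IsCMField.complexConj_ne_one L) w hw) k :
        ↥(unitaryGroupOfForm (galAdicCompletionMap (L := L) (IsCMField.complexConj L) hw) (placeForm (Rogawski1990.qsForm L) w.1))) :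
          GL (Fin 3) (w.1.adicCompletion L)) ∈ glInt 3 (w.1.adicCompletion L)))
    {z : ↥(unitaryGroupOfForm (conjLocal L (IsCMField.complexConj L) v) (cmLocalForm L 3 v))} {β α : w.1.adicCompletion L}
    (hz : (((localNonsplitEquiv (IsCMField.complexConj L) (qsForm L) (IsCMField.complexConj_ne_one L) w hw z :
        ↥(unitaryGroupOfForm (galAdicCompletionMap (L := L) (IsCMField.complexConj L) hw) (placeForm (qsForm L) w.1))) :
        GL (Fin 3) (w.1.adicCompletion L)) : Matrix (Fin 3) (Fin 3) (w.1.adicCompletion L)) = β • (1 : Matrix (Fin 3) (Fin 3) (w.1.adicCompletion L)))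
    (hβ : Valued.v β = 1)
    (ha : (((localNonsplitEquiv (IsCMField.complexConj L) (qsForm L) (IsCMField.complexConj_ne_one L) w hw 𝓘.a :
        ↥(unitaryGroupOfForm (galAdicCompletionMap (L := L) (IsCMField.complexConj L) hw) (placeForm (qsForm L) w.1))) :
        GL (Fin 3) (w.1.adicCompletion L)) : Matrix (Fin 3) (Fin 3) (w.1.adicCompletion L)) =
        Matrix.diagonal ![α, 1, ((galAdicCompletionMap (L := L) (IsCMField.complexConj L) hw) α)⁻¹])
    (hα0 : α ≠ 0) (hα1 : Valued.v α < 1) {m : ℕ} (hm : 1 ≤ m) (hbM : z * 𝓘.a ^ m ∈ (cmBorelTriple L 3 v).M)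
    (𝓘₂ : (cmBorelTriple L 2 v).IwahoriDatum) (nμ : ℕ) :
    ∃ (n' : ℕ) (K₁ : Subgroup ((cmDatum L 1 (Matrix.of fun i j : Fin 1 => if i.val + j.val + 1 = 1 then (1 : L) else 0)).Local v))
      (S' : Subgroup (↥(cmBorelTriple L 2 v).M × (cmDatum L 1 (Matrix.of fun i j : Fin 1 => if i.val + j.val + 1 = 1 then (1 : L) else 0)).Local v)),
      -- (b) the `H`-level
      IsOpen (K₁ : Set ((cmDatum L 1 (Matrix.of fun i j : Fin 1 => if i.val + j.val + 1 = 1 then (1 : L) else 0)).Local v)) ∧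
      IsCompact (K₁ : Set ((cmDatum L 1 (Matrix.of fun i j : Fin 1 => if i.val + j.val + 1 = 1 then (1 : L) else 0)).Local v)) ∧
      (∀ x, x ∈ S' ↔ ((x.1 : ↥(unitaryGroupOfForm (conjLocal L (IsCMField.complexConj L) v) (cmLocalForm L 2 v))) ∈ 𝓘₂.K n' ∧ x.2 ∈ K₁)) ∧
      IsOpen (S' : Set (↥(cmBorelTriple L 2 v).M × (cmDatum L 1 (Matrix.of fun i j : Fin 1 => if i.val + j.val + 1 = 1 then (1 : L) else 0)).Local v)) ∧
      -- (d) BOX at `nμ` (the antecedent of ★ `exists_level_hτ_of_smul_cosets`) and PICK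
      (∀ k ∈ S', (∀ i : Fin 2, ∀ w' : PlacesOver L v,
          Valued.v (((torusEntry (conjLocal L (IsCMField.complexConj L) v) (cmLocalForm L 2 v) i k.1 : (LocalRing L v)ˣ) : LocalRing L v) w' - 1) <
            WithZero.exp (-((nμ + 1 : ℕ) : ℤ))) ∧
        (∀ w' : PlacesOver L v,
          Valued.v (finGammaTwo L v ((k.1 : ↥(unitaryGroupOfForm (conjLocal L (IsCMField.complexConj L) v) (cmLocalForm L 2 v))), k.2) w' - 1) <
            WithZero.exp (-((nμ + 1 : ℕ) : ℤ)))) ∧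
      (∀ k ∈ S', endoEmbLocal L v ((k.1 : ↥(unitaryGroupOfForm (conjLocal L (IsCMField.complexConj L) v) (cmLocalForm L 2 v))), k.2) ∈ 𝓘.K n) ∧
      -- (a) (c) (e): `exists_xigData_hyperbolic` verbatim
      ∃ (w₀ : ↥(unitaryGroupOfForm (conjLocal L (IsCMField.complexConj L) v) (cmLocalForm L 3 v))) (b' : ↥(cmBorelTriple L 3 v).M) (Sn : Subgroup ↥(cmBorelTriple L 3 v).M)
        (F : Finset (↥(cmBorelTriple L 2 v).M × (cmDatum L 1 (Matrix.of fun i j : Fin 1 => if i.val + j.val + 1 = 1 then (1 : L) else 0)).Local v)),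
        Units.val (w₀ : GL (Fin 3) (LocalRing L v)) = cmLocalForm L 3 v ∧ w₀ ∈ K₀ ∧ (∀ n, ∀ κ ∈ 𝓘.K n, w₀ * κ * w₀⁻¹ ∈ 𝓘.K n) ∧
        (b' : ↥(unitaryGroupOfForm (conjLocal L (IsCMField.complexConj L) v) (cmLocalForm L 3 v))) = w₀ * (z * 𝓘.a ^ m) * w₀⁻¹ ∧
        (((localNonsplitEquiv (IsCMField.complexConj L) (qsForm L) (IsCMField.complexConj_ne_one L) w hw
            (b' : ↥(unitaryGroupOfForm (conjLocal L (IsCMField.complexConj L) v) (cmLocalForm L 3 v))) :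
          ↥(unitaryGroupOfForm (galAdicCompletionMap (L := L) (IsCMField.complexConj L) hw) (placeForm (qsForm L) w.1))) :
          GL (Fin 3) (w.1.adicCompletion L)) : Matrix (Fin 3) (Fin 3) (w.1.adicCompletion L)) =
          Matrix.diagonal ![β * ((galAdicCompletionMap (L := L) (IsCMField.complexConj L) hw) α)⁻¹ ^ m, β, β * α ^ m] ∧
        Valued.v (β * α ^ m) < Valued.v (β * ((galAdicCompletionMap (L := L) (IsCMField.complexConj L) hw) α)⁻¹ ^ m) ∧
        Sn = (𝓘.K n).subgroupOf (cmBorelTriple L 3 v).M ∧ IsCompact (Sn : Set ↥(cmBorelTriple L 3 v).M) ∧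
        (∀ s ∈ Sn, (s : ↥(unitaryGroupOfForm (conjLocal L (IsCMField.complexConj L) v) (cmLocalForm L 3 v))) ∈ 𝓘.K n) ∧
        (∀ k ∈ S', ∃ s ∈ Sn,
          endoEmbLocal L v ((k.1 : ↥(unitaryGroupOfForm (conjLocal L (IsCMField.complexConj L) v) (cmLocalForm L 2 v))), k.2) =
            ((s : ↥(cmBorelTriple L 3 v).M) : ↥(unitaryGroupOfForm (conjLocal L (IsCMField.complexConj L) v) (cmLocalForm L 3 v)))) ∧
        (∀ u ∈ F, ∃ t ∈ b' • (Sn : Set ↥(cmBorelTriple L 3 v).M),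
          (t : ↥(unitaryGroupOfForm (conjLocal L (IsCMField.complexConj L) v) (cmLocalForm L 3 v))) =
            endoEmbLocal L v ((u.1 : ↥(unitaryGroupOfForm (conjLocal L (IsCMField.complexConj L) v) (cmLocalForm L 2 v))), u.2)) ∧
        (↑F : Set (↥(cmBorelTriple L 2 v).M ×
          (cmDatum L 1 (Matrix.of fun i j : Fin 1 => if i.val + j.val + 1 = 1 then (1 : L) else 0)).Local v)).PairwiseDisjoint
            (fun u => u • (S' : Set (↥(cmBorelTriple L 2 v).M ×
              (cmDatum L 1 (Matrix.of fun i j : Fin 1 => if i.val + j.val + 1 = 1 then (1 : L) else 0)).Local v))) ∧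
        (fun x : ↥(cmBorelTriple L 2 v).M ×
            (cmDatum L 1 (Matrix.of fun i j : Fin 1 => if i.val + j.val + 1 = 1 then (1 : L) else 0)).Local v =>
          endoEmbLocal L v ((x.1 : ↥(unitaryGroupOfForm (conjLocal L (IsCMField.complexConj L) v) (cmLocalForm L 2 v))), x.2)) ⁻¹'
            (Subtype.val '' (b' • (Sn : Set ↥(cmBorelTriple L 3 v).M))) =
          ⋃ u ∈ F, u • (S' : Set (↥(cmBorelTriple L 2 v).M ×
              (cmDatum L 1 (Matrix.of fun i j : Fin 1 => if i.val + j.val + 1 = 1 then (1 : L) else 0)).Local v)) ∧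
        (∀ (x : ↥(cmBorelTriple L 2 v).M ×
            (cmDatum L 1 (Matrix.of fun i j : Fin 1 => if i.val + j.val + 1 = 1 then (1 : L) else 0)).Local v)
          (t : ↥(cmBorelTriple L 3 v).M),
          (t : ↥(unitaryGroupOfForm (conjLocal L (IsCMField.complexConj L) v) (cmLocalForm L 3 v))) =
            endoEmbLocal L v ((x.1 : ↥(unitaryGroupOfForm (conjLocal L (IsCMField.complexConj L) v) (cmLocalForm L 2 v))), x.2) →
          (t ∈ b' • (Sn : Set ↥(cmBorelTriple L 3 v).M) ↔
            ∃ u ∈ F, x ∈ u • (S' : Set (↥(cmBorelTriple L 2 v).M ×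
              (cmDatum L 1 (Matrix.of fun i j : Fin 1 => if i.val + j.val + 1 = 1 then (1 : L) else 0)).Local v)))) ∧
        -- (e) the representatives are hlevi-ORIENTED hyperbolic (★ REP-HYPERBOLIC, conclusion verbatim)
        ∀ u ∈ F,
          (∃ d' : Fin 2 → (LocalRing L v)ˣ,
            glDiagonal 2 (LocalRing L v) d' = ((u.1 : ↥(unitaryGroupOfForm (conjLocal L (IsCMField.complexConj L) v) (cmLocalForm L 2 v))) : GL (Fin 2) (LocalRing L v)) ∧
            Valued.v (((d' 1 : (LocalRing L v)ˣ) : LocalRing L v) w) < Valued.v (((d' 0 : (LocalRing L v)ˣ) : LocalRing L v) w) ∧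
            galAdicCompletionMap (L := L) (IsCMField.complexConj L) hw (((d' 0 : (LocalRing L v)ˣ) : LocalRing L v) w) * ((d' 1 : (LocalRing L v)ˣ) : LocalRing L v) w = 1) ∧
          (∃ d₀ d₁ : w.1.adicCompletion L,
            (((localNonsplitEquiv (IsCMField.complexConj L) (Matrix.of fun i j : Fin 2 => if i.val + j.val + 1 = 2 then (1 : L) else 0) (IsCMField.complexConj_ne_one L) w hw
                  (u.1 : ↥(unitaryGroupOfForm (conjLocal L (IsCMField.complexConj L) v) (cmLocalForm L 2 v))) :
                ↥(unitaryGroupOfForm (galAdicCompletionMap (L := L) (IsCMField.complexConj L) hw) (placeForm (Matrix.of fun i j : Fin 2 => if i.val + j.val + 1 = 2 then (1 : L) else 0) w.1))) :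
                GL (Fin 2) (w.1.adicCompletion L)) : Matrix (Fin 2) (Fin 2) (w.1.adicCompletion L)) = Matrix.diagonal ![d₀, d₁] ∧
            Valued.v d₁ < Valued.v d₀ ∧ Valued.v d₀ * Valued.v d₁ = 1 ∧ galAdicCompletionMap (L := L) (IsCMField.complexConj L) hw d₀ * d₁ = 1) ∧
          Valued.v (finGammaTwo L v ((u.1 : ↥(unitaryGroupOfForm (conjLocal L (IsCMField.complexConj L) v) (cmLocalForm L 2 v))), u.2) w) = 1 := by
  obtain ⟨n', K₁, hK₁o, hK₁c, hS⟩ := F0P3cStCharTSLevelPickInst.exists_level_K₁_box_pick_subgroup L v 𝓘 n 𝓘₂ nμ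
  obtain ⟨S', hS'mem, hS'o⟩ := exists_levelSubgroupH L v (𝓘₂.K n') (𝓘₂.isOpen_K n') K₁ hK₁o
  obtain ⟨hbox, hpick⟩ := hS S' (fun k hk => (hS'mem k).1 hk)
  exact ⟨n', K₁, S', hK₁o, hK₁c, hS'mem, hS'o, hbox, hpick,
    exists_xigData_hyperbolic L v w hw hns 𝓘 n hr hK K₀ hKK₀ hK₀ hz hβ ha hα0 hα1 hm hbM S' hS'o hpick⟩

end Summit.HodgeConjecture.HodgeConjecture.Cruxes.H413.F0P3cStCharTSXIGDataLevels

end
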